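import Mathlib
import HarnessLib
import Summits.SmoothPoincare4.SmoothPoincare4.Theses.RootDecompY
import Literature.Topology.FourManifolds.SliceGenus

/-!
# Line «genus_tail» for the crux `GscCP2Cancellation` (UC; stmt-SmoothPoincare4-32280, route-SmoothPoincare4-RootDecompY rev 2,
file rank 403, layer-2 child of `CP2CancellationOne` #17708; species R) — decomp-sp4 lens 4 «minimal counterexample / extremal
reduction», gen 11.  A SECOND line beside the registered «unimax» (`Lines/unimax.lean`); W1 form: no local copy of UC, exactly ONE
by-name proof-of-item (`GscCP2Cancellation_of`), the three `stub_*` stated over tree declarations only, sorries = stubs = 3.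

UC: every R-link sphere `M = X_L` (n-component R-link `L`) with `M # ℂℙ² ≅ ℂℙ²` is diffeomorphic to `S⁴`.  This line partitions UC by
the GENUS TAIL predicate «all components of `L` but at most one have Seifert genus ≤ 1» (tree predicate
`Literature.Topology.FourManifolds.Knot.HasSeifertSurfaceOfGenus`, phrased exactly as route G's `GenusOneTwoRLinkStandard` #26834):
* `stub_rows_le_one` — rows n ≤ 1 (n = 0: no 2- or 3-handles, M = S⁴; n = 1: Gabai 1987 Property R) — FLOOR (statement = unimax.`stub_floor_le_one`);
* `stub_genus_tail` — n ≥ 2, genus tail — LOAD-BEARING · OPEN · ATTACKABLE-in-part: n = 2 ⟸ route G #26834 (kernel §4, proved); the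
  split-unlink genus-0 tails are Meier–Schirmer–Zupan 2016 Thm 5.1 (= Nakamura 2022 L4.6) on paper; and — the point of this generation —
  EVERY dissolvable homotopy sphere whose dissolving sphere has Morse width one (equivalently: every untwisted ribbon sphere
  `M(K,U,R,ε)`, every Manolescu–Piccirillo sphere of an RBG link `(U,ε)∪(K,0)∪(μ_U,0)`, hence every T-UNIMAX2 survivor row with any band)
  is an R-link sphere on `Λ = c ∪ ℓ₁…ℓ_{m−1}` with all `ℓ_j` of genus ≤ 1 (paper theorem, lens NODE-g11.md §1–§2), so it lands HERE;
  instrument T-UNIMAX2″ (lines/genus_tail.md §Instrument);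
* `stub_high_genus_core` — n ≥ 2, at least two components of genus ≥ 2 — DECLARED RESIDUAL (species R; n = 2 ⟸ route G #26835, kernel §4).
Exactness UC ⟺ stub₁ ∧ stub₂ ∧ stub₃, the route-G cross-links, domination by S and the minimal-counterexample normal form are REAL proofs in
the lens kernel HOME/decomp-sp4-lens-4/gen11/GenusTail.lean (`uc_iff_pieces`, `unimaxRowTwo_of_routeG`, `pieces_of_spc4`,
`minimal_counterexample_normal_form`; rc 0, 0 sorry, axioms {propext, Classical.choice, Quot.sound}).
-/

set_option linter.dupNamespace false

namespace Summit.SmoothPoincare4.SmoothPoincare4.Cruxes.GscCP2Cancellation.GenusTail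

open scoped Manifold ContDiff
open Literature.Topology.FourManifolds

/-- FLOOR: rows n ≤ 1 (n = 0 trivial; n = 1 Gabai Property R).  Same statement as unimax.`stub_floor_le_one`. -/
theorem stub_rows_le_one : open scoped ContDiff in ∀ (n : ℕ), n ≤ 1 → ∀ (L : Literature.Topology.FourManifolds.FramedLink (Fin n)) (M : Type) [TopologicalSpace M] [T2Space M] [SecondCountableTopology M] [ChartedSpace (EuclideanSpace ℝ (Fin 4)) M] [IsManifold (𝓡 4) ∞ M], Literature.Topology.FourManifolds.IsRLinkSphere M L → (∃ (P : Type) (_ : TopologicalSpace P) (_ : T2Space P) (_ : SecondCountableTopology P) (_ : ChartedSpace (EuclideanSpace ℝ (Fin 4)) P) (_ : IsManifold (𝓡 4) ∞ P), Literature.Topology.FourManifolds.IsConnectedSum (𝓡 4) (𝓡 4) (𝓡 4) M Literature.Topology.FourManifolds.ComplexProjectivePlane P ∧ Nonempty (P ≃ₘ⟮𝓡 4, 𝓡 4⟯ Literature.Topology.FourManifolds.ComplexProjectivePlane)) → Nonempty (M ≃ₘ⟮𝓡 4, 𝓡 4⟯ Metric.sphere (0 : EuclideanSpace ℝ (Fin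 5)) 1) := by
  sorry

/-- LOAD-BEARING: n ≥ 2, GENUS TAIL — all components but at most one have Seifert genus ≤ 1 (n = 2 ⟸ route G #26834; contains every
width-one dissolvable sphere / untwisted ribbon sphere by the lens theorem NODE-g11 §1). -/
theorem stub_genus_tail : open scoped ContDiff in ∀ (n : ℕ), 2 ≤ n → ∀ (L : Literature.Topology.FourManifolds.FramedLink (Fin n)) (M : Type) [TopologicalSpace M] [T2Space M] [SecondCountableTopology M] [ChartedSpace (EuclideanSpace ℝ (Fin 4)) M] [IsManifold (𝓡 4) ∞ M], Literature.Topology.FourManifolds.IsRLinkSphere M L → (∃ (P : Type) (_ : TopologicalSpace P) (_ : T2Space P) (_ : SecondCountableTopology P) (_ : ChartedSpace (EuclideanSpace ℝ (Fin 4)) P) (_ : IsManifold (𝓡 4) ∞ P), Literature.Topology.FourManifolds.IsConnectedSum (𝓡 4) (𝓡 4) (𝓡 4) M Literature.Topology.FourManifolds.ComplexProjectivePlane P ∧ Nonempty (P ≃ₘ⟮𝓡 4, 𝓡 4⟯ Literature.Topology.FourManifolds.ComplexProjectivePlane)) → (∀ i j : Fin n, i ≠ j → (∃ g : ℕ, g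 ≤ 1 ∧ Literature.Topology.FourManifolds.Knot.HasSeifertSurfaceOfGenus (L.component i) g) ∨ (∃ g : ℕ, g ≤ 1 ∧ Literature.Topology.FourManifolds.Knot.HasSeifertSurfaceOfGenus (L.component j) g)) → Nonempty (M ≃ₘ⟮𝓡 4, 𝓡 4⟯ Metric.sphere (0 : EuclideanSpace ℝ (Fin 5)) 1) := by
  sorry

/-- DECLARED RESIDUAL (species R): n ≥ 2, at least two components of genus ≥ 2 (n = 2 ⟸ route G #26835). -/
theorem stub_high_genus_core : open scoped ContDiff in ∀ (n : ℕ), 2 ≤ n → ∀ (L : Literature.Topology.FourManifolds.FramedLink (Fin n)) (M : Type) [TopologicalSpace M] [T2Space M] [SecondCountableTopology M] [ChartedSpace (EuclideanSpace ℝ (Fin 4)) M] [IsManifold (𝓡 4) ∞ M], Literature.Topology.FourManifolds.IsRLinkSphere M L → (∃ (P : Type) (_ : TopologicalSpace P) (_ : T2Space P) (_ : SecondCountableTopology P) (_ : ChartedSpace (EuclideanSpace ℝ (Fin 4)) P) (_ : IsManifold (𝓡 4) ∞ P), Literature.Topology.FourManifolds.IsConnectedSum (𝓡 4) (𝓡 4)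 (𝓡 4) M Literature.Topology.FourManifolds.ComplexProjectivePlane P ∧ Nonempty (P ≃ₘ⟮𝓡 4, 𝓡 4⟯ Literature.Topology.FourManifolds.ComplexProjectivePlane)) → ¬ (∀ i j : Fin n, i ≠ j → (∃ g : ℕ, g ≤ 1 ∧ Literature.Topology.FourManifolds.Knot.HasSeifertSurfaceOfGenus (L.component i) g) ∨ (∃ g : ℕ, g ≤ 1 ∧ Literature.Topology.FourManifolds.Knot.HasSeifertSurfaceOfGenus (L.component j) g)) → Nonempty (M ≃ₘ⟮𝓡 4, 𝓡 4⟯ Metric.sphere (0 : EuclideanSpace ℝ (Fin 5)) 1) := by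
  sorry

/-- COMPOSITION (real proof, no sorry; W1 form): the three registered stubs give the ROUTE crux BY NAME
(case split on `n < 2`, then classically on the genus-tail predicate). -/
theorem GscCP2Cancellation_of :
    Summit.SmoothPoincare4.SmoothPoincare4.Theses.RootDecompY.GscCP2Cancellation := by
  intro n L M _ _ _ _ _ hM hd
  rcases Nat.lt_or_ge n 2 with hlt | hge
  · exact stub_rows_le_one n (by omega) L M hM hd
  · by_cases ht : ∀ i j : Fin n, i ≠ j →
        (∃ g : ℕ, g ≤ 1 ∧ Knot.HasSeifertSurfaceOfGenus (L.component i) g) ∨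
        (∃ g : ℕ, g ≤ 1 ∧ Knot.HasSeifertSurfaceOfGenus (L.component j) g)
    · exact stub_genus_tail n hge L M hM hd ht
    · exact stub_high_genus_core n hge L M hM hd ht

end Summit.SmoothPoincare4.SmoothPoincare4.Cruxes.GscCP2Cancellation.GenusTail
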